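import Mathlib
import HarnessLib
import Summits.RiemannHypothesis.RiemannHypothesis.Theorems.DeBrangesSuzukiDoorTailWitnessSpectral

/-!
# RiemannHypothesis / de Branges–Suzuki door — tail witness, file 2/4: the eventual index bound along a
norm-continuous path of compact self-adjoint operators (RH-FREE, ζ-FREE)

Cell rh-split, target T12 / spectral step L1 (statement of record: hypothesis of the landed p467879).  This file:
* `expansion_bigSpace`, `exists_strict_expansion` — on the big space `‖A v‖ ≥ ‖v‖`, and `≥ (1+η)‖v‖` when `±1` are not
  eigenvalues (orthonormal eigenbasis of the finite-dimensional symmetric restriction);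
* `finrank_le_of_expanding` — a finite-dimensional subspace on which `ρ‖f‖ < ‖A f‖` (`ρ` the contraction constant
  off the big space) has dimension `≤ dim(big space)` (injective orthogonal projection);
* `bigDim_locally_const`, `bigDim_eq` — along a norm-continuous path `t ↦ T t` of compact self-adjoint operators
  with no eigenvalue `±1` for `t > H ≥ 0`, `t ↦ dim(big space of T t)` is locally constant, hence constant, on
  `(H, ∞)` (preconnectedness of `Ioi H`);
* `eventual_index_bound` — ∃ `M`, ∀ `t > H`, every finite-dimensional subspace of dimension `> M` contains
  `g ≠ 0` with `‖T t g‖ ≤ ‖g‖`.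
Zero definitions.  Filed by rh-split-typer-2 g2 (--supports stmt-RiemannHypothesis-19728).
RH-free operator theory; nothing here bears on the truth of RH.
-/

set_option linter.dupNamespace false

noncomputable section

open scoped InnerProductSpace
open Filter Topology Module Module.End

namespace Summit.RiemannHypothesis.RiemannHypothesis.Theorems.SuzukiDoorTailWitness

variable {E : Type*} [NormedAddCommGroup E] [InnerProductSpace ℝ E] [CompleteSpace E]
variable {A : E →L[ℝ] E}

/-! ## 5. Expansion on the big spectral subspace -/

/-- Eigenvectors of the restriction of `A` to `(⨆ μ : ↥{μ : ℝ | 1 ≤ |μ| ∧ HasEigenvalue ((A : E →L[ℝ] E) : E →ₗ[ℝ] E) μ}, eigenspace ((A : E →L[ℝ] E) : E →ₗ[ℝ] E) (μ : ℝ))` have eigenvalues of modulus `≥ 1`. -/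
theorem one_le_abs_of_eigen_mem_bigSpace (hsa : IsSelfAdjoint A) {v : E} {lam : ℝ}
    (hvS : v ∈ (⨆ μ : ↥{μ : ℝ | 1 ≤ |μ| ∧ HasEigenvalue ((A : E →L[ℝ] E) : E →ₗ[ℝ] E) μ}, eigenspace ((A : E →L[ℝ] E) : E →ₗ[ℝ] E) (μ : ℝ))) (hv0 : v ≠ 0) (hv : A v = lam • v) : 1 ≤ |lam| := by
  by_contra hlt
  push Not at hlt
  have hsym : (A : E →ₗ[ℝ] E).IsSymmetric := hsa.isSymmetric
  -- v is orthogonal to every eigenspace with |μ| ≥ 1, hence to bigSpace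
  have hvorth : v ∈ (⨆ μ : ↥{μ : ℝ | 1 ≤ |μ| ∧ HasEigenvalue ((A : E →L[ℝ] E) : E →ₗ[ℝ] E) μ}, eigenspace ((A : E →L[ℝ] E) : E →ₗ[ℝ] E) (μ : ℝ))ᗮ := by
    rw [← Submodule.iInf_orthogonal, Submodule.mem_iInf]
    intro μ
    rw [Submodule.mem_orthogonal]
    intro u hu
    have hne : (μ : ℝ) ≠ lam := by
      intro h; have := μ.2.1; rw [h] at this; exact absurd this (not_le.2 hlt)
    have hvmem : v ∈ eigenspace (A : E →ₗ[ℝ] E) lam := mem_eigenspace_iff.2 hv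
    exact hsym.orthogonalFamily_eigenspaces hne ⟨u, hu⟩ ⟨v, hvmem⟩
  have : ⟪v, v⟫_ℝ = 0 := (Submodule.mem_orthogonal _ _).1 hvorth v hvS
  exact hv0 (inner_self_eq_zero.1 this)

/-- **Expansion on `(⨆ μ : ↥{μ : ℝ | 1 ≤ |μ| ∧ HasEigenvalue ((A : E →L[ℝ] E) : E →ₗ[ℝ] E) μ}, eigenspace ((A : E →L[ℝ] E) : E →ₗ[ℝ] E) (μ : ℝ))`**, quantitative form: if every eigenvalue `λ` of `A` with `1 ≤ |λ|` in fact has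
`c ≤ |λ|` (`c ≥ 0`), then `c ‖v‖ ≤ ‖A v‖` on `(⨆ μ : ↥{μ : ℝ | 1 ≤ |μ| ∧ HasEigenvalue ((A : E →L[ℝ] E) : E →ₗ[ℝ] E) μ}, eigenspace ((A : E →L[ℝ] E) : E →ₗ[ℝ] E) (μ : ℝ))` (orthonormal eigenbasis of the finite-dimensional
symmetric restriction). -/
theorem expansion_bigSpace (hsa : IsSelfAdjoint A) (hk : IsCompactOperator A) {c : ℝ} (hc : 0 ≤ c)
    (hgap : ∀ (v : E) (μ : ℝ), v ≠ 0 → A v = μ • v → 1 ≤ |μ| → c ≤ |μ|) :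
    ∀ v ∈ (⨆ μ : ↥{μ : ℝ | 1 ≤ |μ| ∧ HasEigenvalue ((A : E →L[ℝ] E) : E →ₗ[ℝ] E) μ}, eigenspace ((A : E →L[ℝ] E) : E →ₗ[ℝ] E) (μ : ℝ)), c * ‖v‖ ≤ ‖A v‖ := by
  haveI := finiteDimensional_bigSpace hsa hk
  set S : Submodule ℝ E := (⨆ μ : ↥{μ : ℝ | 1 ≤ |μ| ∧ HasEigenvalue ((A : E →L[ℝ] E) : E →ₗ[ℝ] E) μ}, eigenspace ((A : E →L[ℝ] E) : E →ₗ[ℝ] E) (μ : ℝ)) with hS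
  have hinv : ∀ v ∈ S, A v ∈ S := bigSpace_invariant
  set AS : S →ₗ[ℝ] S := (A : E →ₗ[ℝ] E).restrict hinv with hAS
  have hsym : (A : E →ₗ[ℝ] E).IsSymmetric := hsa.isSymmetric
  have hsymS : AS.IsSymmetric := hsym.restrict_invariant hinv
  set n := finrank ℝ S with hn
  let b := hsymS.eigenvectorBasis hn.symm
  let ev := hsymS.eigenvalues hn.symm
  have hb : ∀ i, AS (b i) = (ev i : ℝ) • b i := fun i => hsymS.apply_eigenvectorBasis hn.symm i
  -- each |ev i| ≥ c
  have hev : ∀ i, c ≤ |ev i| := by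
    intro i
    have hbi0 : (b i : E) ≠ 0 := by
      intro h
      have : b i = 0 := Subtype.ext h
      exact (b.toBasis.ne_zero i) (by simpa using this)
    have hAbi : A (b i : E) = (ev i) • (b i : E) := by
      have := congrArg (fun w : S => (w : E)) (hb i)
      simpa [hAS] using this
    exact hgap _ _ hbi0 hAbi (one_le_abs_of_eigen_mem_bigSpace hsa (b i).2 hbi0 hAbi)
  intro v hv
  -- work inside S
  set w : S := ⟨v, hv⟩ with hw
  have hnormv : ‖v‖ = ‖w‖ := rfl
  have hnormAv : ‖A v‖ = ‖AS w‖ := rfl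
  rw [hnormv, hnormAv]
  -- ‖x‖² = Σ ⟪b i, x⟫²
  have hparseval : ∀ x : S, ‖x‖ ^ 2 = ∑ i, ⟪(b i : S), x⟫_ℝ ^ 2 := by
    intro x
    rw [← real_inner_self_eq_norm_sq, ← b.sum_inner_mul_inner x x]
    refine Finset.sum_congr rfl fun i _ => ?_
    rw [real_inner_comm x, sq]
  have hcoef : ∀ i, ⟪(b i : S), AS w⟫_ℝ = ev i * ⟪(b i : S), w⟫_ℝ := by
    intro i
    rw [← hsymS (b i) w, hb i, real_inner_smul_left]
  have hsq : (c * ‖w‖) ^ 2 ≤ ‖AS w‖ ^ 2 := by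
    rw [mul_pow, hparseval w, hparseval (AS w), Finset.mul_sum]
    refine Finset.sum_le_sum fun i _ => ?_
    rw [hcoef i, mul_pow]
    have h1 : c ^ 2 ≤ (ev i) ^ 2 := by
      calc c ^ 2 ≤ |ev i| ^ 2 := pow_le_pow_left₀ hc (hev i) 2
        _ = (ev i) ^ 2 := sq_abs _
    exact mul_le_mul_of_nonneg_right h1 (sq_nonneg _)
  have h0 : 0 ≤ c * ‖w‖ := mul_nonneg hc (norm_nonneg _)
  nlinarith [norm_nonneg (AS w), hsq, h0]

/-- Non-strict expansion: `‖v‖ ≤ ‖A v‖` on `(⨆ μ : ↥{μ : ℝ | 1 ≤ |μ| ∧ HasEigenvalue ((A : E →L[ℝ] E) : E →ₗ[ℝ] E) μ}, eigenspace ((A : E →L[ℝ] E) : E →ₗ[ℝ] E) (μ : ℝ))`. -/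
theorem norm_le_norm_apply_of_mem_bigSpace (hsa : IsSelfAdjoint A) (hk : IsCompactOperator A) :
    ∀ v ∈ (⨆ μ : ↥{μ : ℝ | 1 ≤ |μ| ∧ HasEigenvalue ((A : E →L[ℝ] E) : E →ₗ[ℝ] E) μ}, eigenspace ((A : E →L[ℝ] E) : E →ₗ[ℝ] E) (μ : ℝ)), ‖v‖ ≤ ‖A v‖ := by
  intro v hv
  have := expansion_bigSpace hsa hk zero_le_one (fun _ _ _ _ h => h) v hv
  rwa [one_mul] at this

/-- Strict expansion when `±1` are not eigenvalues: some `η > 0` with `(1 + η)‖v‖ ≤ ‖A v‖` on `(⨆ μ : ↥{μ : ℝ | 1 ≤ |μ| ∧ HasEigenvalue ((A : E →L[ℝ] E) : E →ₗ[ℝ] E) μ}, eigenspace ((A : E →L[ℝ] E) : E →ₗ[ℝ] E) (μ : ℝ))`. -/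
theorem exists_strict_expansion (hsa : IsSelfAdjoint A) (hk : IsCompactOperator A)
    (hno : ∀ v : E, (A v = v ∨ A v = -v) → v = 0) :
    ∃ η : ℝ, 0 < η ∧ ∀ v ∈ (⨆ μ : ↥{μ : ℝ | 1 ≤ |μ| ∧ HasEigenvalue ((A : E →L[ℝ] E) : E →ₗ[ℝ] E) μ}, eigenspace ((A : E →L[ℝ] E) : E →ₗ[ℝ] E) (μ : ℝ)), (1 + η) * ‖v‖ ≤ ‖A v‖ := by
  -- the finite set of big eigenvalues has all |μ| > 1; take c = their minimum modulus (or 2 if empty)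
  have hfin := finite_eigenvalues_abs_ge A hsa hk one_pos
  have hgt : ∀ μ ∈ {μ : ℝ | 1 ≤ |μ| ∧ HasEigenvalue ((A : E →L[ℝ] E) : E →ₗ[ℝ] E) μ}, 1 < |μ| := by
    intro μ hμ
    rcases hμ.1.lt_or_eq with h | h
    · exact h
    · exfalso
      obtain ⟨v, hv⟩ := hμ.2.exists_hasEigenvector
      have hAv : A v = μ • v := mem_eigenspace_iff.1 hv.1
      have : v = 0 := by
        rcases (abs_eq (zero_le_one)).1 h.symm with h1 | h1
        · exact hno v (Or.inl (by rw [hAv, h1, one_smul]))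
        · exact hno v (Or.inr (by rw [hAv, h1, neg_one_smul]))
      exact hv.2 this
  -- minimum over the finite set
  by_cases hne : ({μ : ℝ | 1 ≤ |μ| ∧ HasEigenvalue ((A : E →L[ℝ] E) : E →ₗ[ℝ] E) μ}).Nonempty
  · obtain ⟨μ₀, hμ₀, hmin⟩ := hfin.exists_minimalFor (fun μ => |μ|) ({μ : ℝ | 1 ≤ |μ| ∧ HasEigenvalue ((A : E →L[ℝ] E) : E →ₗ[ℝ] E) μ}) hne
    refine ⟨|μ₀| - 1, sub_pos.2 (hgt μ₀ hμ₀), ?_⟩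
    have hc : 0 ≤ |μ₀| := abs_nonneg _
    have := expansion_bigSpace hsa hk hc ?_
    · intro v hv; have h := this v hv; rwa [add_sub_cancel]
    · intro v μ hv0 hAv hμ
      have hμmem : μ ∈ {μ : ℝ | 1 ≤ |μ| ∧ HasEigenvalue ((A : E →L[ℝ] E) : E →ₗ[ℝ] E) μ} :=
        ⟨hμ, hasEigenvalue_of_hasEigenvector ⟨mem_eigenspace_iff.2 hAv, hv0⟩⟩
      by_contra hlt
      push Not at hlt
      have := hmin hμmem hlt.le
      exact absurd (lt_of_lt_of_le hlt this) (lt_irrefl _)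
  · refine ⟨1, one_pos, ?_⟩
    have := expansion_bigSpace hsa hk (c := 2) (by norm_num) ?_
    · intro v hv; have h := this v hv; norm_num at h ⊢; exact h
    · intro v μ hv0 hAv hμ
      exact absurd ⟨μ, hμ, hasEigenvalue_of_hasEigenvector ⟨mem_eigenspace_iff.2 hAv, hv0⟩⟩ hne

/-! ## 6. Injective projection: dimension comparison -/

/-- **Injective projection.** If `‖A w‖ ≤ ρ‖w‖` on `(⨆ μ : ↥{μ : ℝ | 1 ≤ |μ| ∧ HasEigenvalue ((A : E →L[ℝ] E) : E →ₗ[ℝ] E) μ}, eigenspace ((A : E →L[ℝ] E) : E →ₗ[ℝ] E) (μ : ℝ))ᗮ` and a finite-dimensional subspace `W`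
satisfies `ρ‖f‖ < ‖A f‖` for its non-zero vectors, then the orthogonal projection onto `(⨆ μ : ↥{μ : ℝ | 1 ≤ |μ| ∧ HasEigenvalue ((A : E →L[ℝ] E) : E →ₗ[ℝ] E) μ}, eigenspace ((A : E →L[ℝ] E) : E →ₗ[ℝ] E) (μ : ℝ))` is injective
on `W`, so `dim W ≤ dim (⨆ μ : ↥{μ : ℝ | 1 ≤ |μ| ∧ HasEigenvalue ((A : E →L[ℝ] E) : E →ₗ[ℝ] E) μ}, eigenspace ((A : E →L[ℝ] E) : E →ₗ[ℝ] E) (μ : ℝ))`. -/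
theorem finrank_le_of_expanding (hsa : IsSelfAdjoint A) (hk : IsCompactOperator A) {ρ : ℝ}
    (hρ : ∀ w ∈ (⨆ μ : ↥{μ : ℝ | 1 ≤ |μ| ∧ HasEigenvalue ((A : E →L[ℝ] E) : E →ₗ[ℝ] E) μ}, eigenspace ((A : E →L[ℝ] E) : E →ₗ[ℝ] E) (μ : ℝ))ᗮ, ‖A w‖ ≤ ρ * ‖w‖) (W : Submodule ℝ E) [FiniteDimensional ℝ W]
    (hW : ∀ f ∈ W, f ≠ 0 → ρ * ‖f‖ < ‖A f‖) :
    finrank ℝ W ≤ finrank ℝ ↥(⨆ μ : ↥{μ : ℝ | 1 ≤ |μ| ∧ HasEigenvalue ((A : E →L[ℝ] E) : E →ₗ[ℝ] E) μ}, eigenspace ((A : E →L[ℝ] E) : E →ₗ[ℝ] E) (μ : ℝ)) := by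
  haveI := finiteDimensional_bigSpace hsa hk
  set S : Submodule ℝ E := (⨆ μ : ↥{μ : ℝ | 1 ≤ |μ| ∧ HasEigenvalue ((A : E →L[ℝ] E) : E →ₗ[ℝ] E) μ}, eigenspace ((A : E →L[ℝ] E) : E →ₗ[ℝ] E) (μ : ℝ)) with hS
  let P : E →L[ℝ] S := S.orthogonalProjectionOnto
  let L : W →ₗ[ℝ] S := (P : E →ₗ[ℝ] S) ∘ₗ W.subtype
  have hinj : Function.Injective L := by
    intro f g hfg
    have h0 : L (f - g) = 0 := by rw [map_sub, hfg, sub_self]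
    have hmem : ((f - g : W) : E) ∈ Sᗮ := by
      have : P ((f - g : W) : E) = 0 := h0
      exact (Submodule.orthogonalProjectionOnto_eq_zero_iff).1 this
    by_contra hne
    have hne' : ((f - g : W) : E) ≠ 0 := by
      intro h; exact hne (sub_eq_zero.1 (Subtype.ext h))
    have h1 := hW _ (f - g).2 hne'
    have h2 := hρ _ hmem
    linarith
  exact LinearMap.finrank_le_finrank_of_injective hinj

/-! ## 7. The eventual index bound along a norm-continuous path -/

omit [CompleteSpace E] in
/-- `‖B f‖ ≥ ‖A f‖ − ‖A − B‖‖f‖` for bounded operators. -/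
theorem norm_apply_ge_sub (A B : E →L[ℝ] E) (f : E) : ‖A f‖ - ‖A - B‖ * ‖f‖ ≤ ‖B f‖ := by
  have h1 : ‖A f - B f‖ ≤ ‖A - B‖ * ‖f‖ := (A - B).le_opNorm f
  have h2 : ‖A f‖ ≤ ‖B f‖ + ‖A f - B f‖ := by
    calc ‖A f‖ = ‖B f + (A f - B f)‖ := by congr 1; abel
      _ ≤ ‖B f‖ + ‖A f - B f‖ := norm_add_le _ _
  linarith

/-- **Local constancy of the index.** Along a norm-continuous path of compact self-adjoint operators with no
eigenvalue `±1` beyond `H ≥ 0`, `t ↦ dim (⨆ μ : ↥{μ : ℝ | 1 ≤ |μ| ∧ HasEigenvalue ((T t : E →L[ℝ] E) : E →ₗ[ℝ] E) μ}, eigenspace ((T t : E →L[ℝ] E) : E →ₗ[ℝ] E) (μ : ℝ))` is locally constant on `(H, ∞)`. -/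
theorem bigDim_locally_const (T : ℝ → E →L[ℝ] E) (hc : Continuous T)
    (hsa : ∀ t : ℝ, 0 ≤ t → IsSelfAdjoint (T t)) (hk : ∀ t : ℝ, 0 ≤ t → IsCompactOperator (T t))
    {H : ℝ} (hH : 0 ≤ H) (hno : ∀ t : ℝ, H < t → ∀ v : E, (T t v = v ∨ T t v = -v) → v = 0)
    {t₀ : ℝ} (ht₀ : H < t₀) :
    ∃ δ > 0, ∀ t : ℝ, H < t → |t - t₀| < δ → finrank ℝ ↥(⨆ μ : ↥{μ : ℝ | 1 ≤ |μ| ∧ HasEigenvalue ((T t : E →L[ℝ] E) : E →ₗ[ℝ] E) μ}, eigenspace ((T t : E →L[ℝ] E) : E →ₗ[ℝ] E) (μ : ℝ)) = finrank ℝ ↥(⨆ μ : ↥{μ : ℝ | 1 ≤ |μ| ∧ HasEigenvalue ((T t₀ : E →L[ℝ] E) : E →ₗ[ℝ] E) μ}, eigenspace ((T t₀ : E →L[ℝ] E) : E →ₗ[ℝ] E) (μ : ℝ)) := by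
  have h0 : 0 ≤ t₀ := hH.trans ht₀.le
  obtain ⟨ρ, -, hρ1, hρ⟩ := exists_contraction_orthogonal (hsa t₀ h0) (hk t₀ h0)
  obtain ⟨η, hη, hηexp⟩ := exists_strict_expansion (hsa t₀ h0) (hk t₀ h0) (hno t₀ ht₀)
  have hev : ∀ᶠ t in 𝓝 t₀, ‖T t - T t₀‖ < min (1 - ρ) η :=
    (tendsto_iff_norm_sub_tendsto_zero.1 (hc.tendsto t₀)).eventually
      (gt_mem_nhds (lt_min (sub_pos.2 hρ1) hη))
  obtain ⟨δ, hδ, hball⟩ := Metric.eventually_nhds_iff.1 hev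
  refine ⟨δ, hδ, fun t ht htδ => ?_⟩
  have htt : ‖T t - T t₀‖ < min (1 - ρ) η := hball (by rwa [Real.dist_eq])
  have ht0 : 0 ≤ t := hH.trans ht.le
  haveI := finiteDimensional_bigSpace (hsa t ht0) (hk t ht0)
  haveI := finiteDimensional_bigSpace (hsa t₀ h0) (hk t₀ h0)
  apply le_antisymm
  · -- dim big(T t) ≤ dim big(T t₀)
    refine finrank_le_of_expanding (hsa t₀ h0) (hk t₀ h0) hρ ((⨆ μ : ↥{μ : ℝ | 1 ≤ |μ| ∧ HasEigenvalue ((T t : E →L[ℝ] E) : E →ₗ[ℝ] E) μ}, eigenspace ((T t : E →L[ℝ] E) : E →ₗ[ℝ] E) (μ : ℝ))) ?_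
    intro f hf hf0
    have h1 : ‖f‖ ≤ ‖T t f‖ := norm_le_norm_apply_of_mem_bigSpace (hsa t ht0) (hk t ht0) f hf
    have h2 := norm_apply_ge_sub (T t) (T t₀) f
    have h3 : ‖T t - T t₀‖ < 1 - ρ := lt_of_lt_of_le htt (min_le_left _ _)
    have hfpos : 0 < ‖f‖ := norm_pos_iff.2 hf0
    nlinarith
  · -- dim big(T t₀) ≤ dim big(T t)
    obtain ⟨ρt, -, hρt1, hρt⟩ := exists_contraction_orthogonal (hsa t ht0) (hk t ht0)
    refine finrank_le_of_expanding (hsa t ht0) (hk t ht0) hρt ((⨆ μ : ↥{μ : ℝ | 1 ≤ |μ| ∧ HasEigenvalue ((T t₀ : E →L[ℝ] E) : E →ₗ[ℝ] E) μ}, eigenspace ((T t₀ : E →L[ℝ] E) : E →ₗ[ℝ] E) (μ : ℝ))) ?_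
    intro f hf hf0
    have h1 : (1 + η) * ‖f‖ ≤ ‖T t₀ f‖ := hηexp f hf
    have h2 := norm_apply_ge_sub (T t₀) (T t) f
    have h3 : ‖T t₀ - T t‖ < η := by
      rw [norm_sub_rev]; exact lt_of_lt_of_le htt (min_le_right _ _)
    have hfpos : 0 < ‖f‖ := norm_pos_iff.2 hf0
    nlinarith

/-- **The index is constant on `(H, ∞)`** (locally constant on a preconnected set). -/
theorem bigDim_eq (T : ℝ → E →L[ℝ] E) (hc : Continuous T)
    (hsa : ∀ t : ℝ, 0 ≤ t → IsSelfAdjoint (T t)) (hk : ∀ t : ℝ, 0 ≤ t → IsCompactOperator (T t))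
    {H : ℝ} (hH : 0 ≤ H) (hno : ∀ t : ℝ, H < t → ∀ v : E, (T t v = v ∨ T t v = -v) → v = 0)
    {t : ℝ} (ht : H < t) : finrank ℝ ↥(⨆ μ : ↥{μ : ℝ | 1 ≤ |μ| ∧ HasEigenvalue ((T t : E →L[ℝ] E) : E →ₗ[ℝ] E) μ}, eigenspace ((T t : E →L[ℝ] E) : E →ₗ[ℝ] E) (μ : ℝ)) = finrank ℝ ↥(⨆ μ : ↥{μ : ℝ | 1 ≤ |μ| ∧ HasEigenvalue ((T (H + 1) : E →L[ℝ] E) : E →ₗ[ℝ] E) μ}, eigenspace ((T (H + 1) : E →L[ℝ] E) : E →ₗ[ℝ] E) (μ : ℝ)) := by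
  let f : Set.Ioi H → ℕ := fun x => finrank ℝ ↥(⨆ μ : ↥{μ : ℝ | 1 ≤ |μ| ∧ HasEigenvalue ((T (x : ℝ) : E →L[ℝ] E) : E →ₗ[ℝ] E) μ}, eigenspace ((T (x : ℝ) : E →L[ℝ] E) : E →ₗ[ℝ] E) (μ : ℝ))
  have hlc : IsLocallyConstant f := by
    rw [IsLocallyConstant.iff_exists_open]
    intro x
    obtain ⟨δ, hδ, hδeq⟩ := bigDim_locally_const T hc hsa hk hH hno x.2
    refine ⟨Subtype.val ⁻¹' Metric.ball (x : ℝ) δ, ?_, ?_, ?_⟩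
    · exact continuous_subtype_val.isOpen_preimage _ Metric.isOpen_ball
    · simp [hδ]
    · intro y hy
      have hy' : dist (y : ℝ) (x : ℝ) < δ := hy
      rw [Real.dist_eq] at hy'
      exact hδeq y y.2 hy'
  have hpre : IsPreconnected (Set.univ : Set (Set.Ioi H)) := by
    haveI : PreconnectedSpace (Set.Ioi H) := Subtype.preconnectedSpace isPreconnected_Ioi
    exact isPreconnected_univ
  exact hlc.apply_eq_of_isPreconnected hpre (x := ⟨t, ht⟩) (y := ⟨H + 1, by
    show H < H + 1; linarith⟩) (Set.mem_univ _) (Set.mem_univ _)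

/-- **Eventual index bound.** Along a norm-continuous path of compact self-adjoint operators with no
eigenvalue `±1` for `t > H` (`H ≥ 0`), there is `M` such that for every `t > H` every finite-dimensional
subspace of dimension `> M` contains a non-zero `g` with `‖T t g‖ ≤ ‖g‖`. -/
theorem eventual_index_bound (T : ℝ → E →L[ℝ] E) (hc : Continuous T)
    (hsa : ∀ t : ℝ, 0 ≤ t → IsSelfAdjoint (T t)) (hk : ∀ t : ℝ, 0 ≤ t → IsCompactOperator (T t))
    {H : ℝ} (hH : 0 ≤ H) (hno : ∀ t : ℝ, H < t → ∀ v : E, (T t v = v ∨ T t v = -v) → v = 0) :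
    ∃ M : ℕ, ∀ t : ℝ, H < t → ∀ W : Submodule ℝ E, FiniteDimensional ℝ W → M < finrank ℝ W →
      ∃ g ∈ W, g ≠ 0 ∧ ‖T t g‖ ≤ ‖g‖ := by
  refine ⟨finrank ℝ ↥(⨆ μ : ↥{μ : ℝ | 1 ≤ |μ| ∧ HasEigenvalue ((T (H + 1) : E →L[ℝ] E) : E →ₗ[ℝ] E) μ}, eigenspace ((T (H + 1) : E →L[ℝ] E) : E →ₗ[ℝ] E) (μ : ℝ)), fun t ht W hW hM => ?_⟩
  by_contra hcon
  push Not at hcon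
  have ht0 : 0 ≤ t := hH.trans ht.le
  obtain ⟨ρ, -, hρ1, hρ⟩ := exists_contraction_orthogonal (hsa t ht0) (hk t ht0)
  haveI := hW
  have hle : finrank ℝ W ≤ finrank ℝ (↥(⨆ μ : ↥{μ : ℝ | 1 ≤ |μ| ∧ HasEigenvalue ((T t : E →L[ℝ] E) : E →ₗ[ℝ] E) μ}, eigenspace ((T t : E →L[ℝ] E) : E →ₗ[ℝ] E) (μ : ℝ))) := by
    refine finrank_le_of_expanding (hsa t ht0) (hk t ht0) hρ W fun f hf hf0 => ?_
    have h1 := hcon f hf hf0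
    have h2 : ρ * ‖f‖ ≤ ‖f‖ := by nlinarith [norm_nonneg f]
    linarith
  have heq : finrank ℝ (↥(⨆ μ : ↥{μ : ℝ | 1 ≤ |μ| ∧ HasEigenvalue ((T t : E →L[ℝ] E) : E →ₗ[ℝ] E) μ}, eigenspace ((T t : E →L[ℝ] E) : E →ₗ[ℝ] E) (μ : ℝ))) = finrank ℝ ↥(⨆ μ : ↥{μ : ℝ | 1 ≤ |μ| ∧ HasEigenvalue ((T (H + 1) : E →L[ℝ] E) : E →ₗ[ℝ] E) μ}, eigenspace ((T (H + 1) : E →L[ℝ] E) : E →ₗ[ℝ] E) (μ : ℝ)) := bigDim_eq T hc hsa hk hH hno ht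
  omega

end Summit.RiemannHypothesis.RiemannHypothesis.Theorems.SuzukiDoorTailWitness

end
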